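import Summits.HodgeConjecture.CorCM.AbelianOddPartCharacterInduction
import Summits.HodgeConjecture.CorCM.AbelianTwoGroupInvolutionLemmas
import HarnessLib

/-!
# Subgroup MODELS for the character induction, and the sign-set calculus on `ℤ/2 × X`

COR-CM (cell `pub-hodgecm2`), binder seat b04 (gen 18), count-neutral claim ABELIAN-ODD-PART, part IIa.
KERNEL ONLY: theorems; no definition, no named fact, no `sorry`.  `HC_CM` is neither used nor claimed.

* §1 **`exists_finset_of_model_char`** — part I (`AbelianOddPart.exists_finset_of_subgroup_char`) read on a
  MODEL: an injective additive-to-multiplicative homomorphism `j : M ↪ G` with `j(c₀) = c`, CM sets `T₀, T₁ ⊆ M`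
  for `c₀` (`T₀` with trivial stabiliser, not a translate of `T₁`) and a character `χ` of `G` with
  `Σ_{T₀} χ∘j = Σ_{T₁} χ∘j = 0` give a CM set on `G` for `c` with trivial stabiliser killed by `χ`; field level
  **`exists_isPrimitive_not_isNondegenerate_of_model_char`**, **`exists_simple_degenerate_of_model_char`**
  (`K/ℚ` Galois CM with commutative Galois group, `χ` odd: a PRIMITIVE DEGENERATE CM type, realised by a SIMPLE
  CM abelian variety with an exceptional Hodge class on a power).
* §2 the SIGN-SET calculus.  Every model of parts IIb/III is `M = ℤ/2 × X` with `c₀ = (1, 0)`, and a CM set for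
  `c₀` is the same as a subset `N ⊆ X` (the places of sign `−1`): `T_N = {(i, x) : i = 1 ↔ x ∈ N}`
  (`signSet_cm`).  Its stabiliser is trivial iff `N` is invariant under no non-zero translation and no translate
  of `N` is its complement (`signSet_prim`); `T_{N₀}` is not a translate of `T_{N₁}` under the analogous pair of
  conditions (`signSet_ntr`); and for a character `χ` of `M` with `χ(c₀) = −1`,
  `Σ_{T_N} χ = Σ_{x ∈ X} χ(0,x) − 2 Σ_{x ∈ N} χ(0,x)` (`sum_signSet`) — so `T_N` is killed by `χ` when `χ` is
  trivial on `X` and `2|N| = |X|` (the BALANCED mechanism, `sum_signSet_eq_zero_of_trivial`) or when `χ|_X` is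
  non-trivial and `Σ_N χ = 0` (the VANISHING-SUM mechanism, `sum_signSet_eq_zero_of_sum_eq_zero`).

## References

* [Kubota1965] T. Kubota, *On the field extension by complex multiplication*, Trans. AMS 118 (1965), §4 Lemma 2.
* [Shimura1998] G. Shimura, *Abelian Varieties with Complex Multiplication and Modular Functions*, §6.2 Thm. 3,
  §8.1, §8.2 Prop. 26.
* [Gordon1999HodgeAVSurvey] B. B. Gordon, *A survey of the Hodge conjecture for abelian varieties*, Prop. 9.4.1,
  §9.4.2, Thm. 6.4.
-/

noncomputable section

open CategoryTheory CategoryTheory.Limits NumberField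

namespace Summit.HodgeConjecture.CorCM.AbelianOddPart

open Literature.NumberTheory.ComplexMultiplication
open Literature.AlgebraicGeometry.Motives (AbelianVariety CMType)
open Literature.AlgebraicGeometry.HodgeTheory
open Literature.AlgebraicGeometry.ComplexMultiplication (IsCMTypeRealisation isSimple_iff_isPrimitive)
open Literature.AlgebraicGeometry.Pohlmann1968
open Literature.Barriers.HodgeConjecture (divisorClassesSpan)
open Summit.HodgeConjecture.CorCM.AbelianSixteen (exists_simple_realisation_of_isPrimitive)
open Summit.HodgeConjecture.CorCM.TwoGroupPieces (zmod_two_cases)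

open scoped Classical

/-! ## §1 Models: injective additive homomorphisms into the group -/

section Model

variable {G : Type*} [CommGroup G] [Fintype G]
variable {M : Type*} [AddCommGroup M]

/-- **SUBGROUP INDUCTION, character form, on a MODEL (group level).**  Let `j : M → G` be an injective
homomorphism (additive to multiplicative), `T₀, T₁ ⊆ M` CM sets for `c₀` (`x ∈ Tᵢ ↔ c₀ + x ∉ Tᵢ`), `T₀` with trivial
stabiliser and not a translate of `T₁`, and `χ` a character of `G` with `Σ_{T₀} χ∘j = Σ_{T₁} χ∘j = 0`.  Then `G`
carries a CM set for `c = j(c₀)` with TRIVIAL stabiliser on which `χ` vanishes (part I on the subgroup `j(M)`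
with the sets `j(T₀)`, `j(T₁)`). [cite: Kubota1965, §4 Lemma 2] -/
theorem exists_finset_of_model_char (j : M →+ Additive G) (hj : Function.Injective j) (c₀ : M)
    (T₀ T₁ : Finset M) (hcm₀ : ∀ x : M, x ∈ T₀ ↔ c₀ + x ∉ T₀) (hcm₁ : ∀ x : M, x ∈ T₁ ↔ c₀ + x ∉ T₁)
    (hprim : ∀ v : M, v ≠ 0 → ∃ w : M, ¬ (w ∈ T₀ ↔ v + w ∈ T₀))
    (hntr : ∀ d : M, ∃ w : M, ¬ (w ∈ T₁ ↔ d + w ∈ T₀))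
    (χ : AddChar (Additive G) ℂ) (hχ₀ : ∑ x ∈ T₀, χ (j x) = 0) (hχ₁ : ∑ x ∈ T₁, χ (j x) = 0) :
    ∃ T : Finset G, (∀ g : G, g ∈ T ↔ Additive.toMul (j c₀) * g ∉ T) ∧
      (∀ v : G, v ≠ 1 → ∃ w : G, ¬ (w ∈ T ↔ v * w ∈ T)) ∧ ∑ g ∈ T, χ (Additive.ofMul g) = 0 := by
  set ι : M → G := fun m => Additive.toMul (j m) with hι
  have hιadd : ∀ a b : M, ι (a + b) = ι a * ι b := fun a b => by simp only [hι, map_add, toMul_add]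
  have hιzero : ι 0 = 1 := by simp only [hι, map_zero, toMul_zero]
  have hιneg : ∀ a : M, ι (-a) = (ι a)⁻¹ := fun a => by simp only [hι, map_neg, toMul_neg]
  have hιinj : Function.Injective ι := fun a b h => hj (Additive.toMul.injective h)
  obtain ⟨G', hG'⟩ : ∃ G' : Subgroup G, ∀ g, g ∈ G' ↔ ∃ m, ι m = g :=
    ⟨{ carrier := {g | ∃ m, ι m = g}
       mul_mem' := by
         rintro a b ⟨m, rfl⟩ ⟨m', rfl⟩
         exact ⟨m + m', hιadd m m'⟩
       one_mem' := ⟨0, hιzero⟩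
       inv_mem' := by
         rintro a ⟨m, rfl⟩
         exact ⟨-m, hιneg m⟩ }, fun _ => Iff.rfl⟩
  have hmemI : ∀ (S : Finset M) (m : M), ι m ∈ S.image ι ↔ m ∈ S := fun S m => hιinj.mem_finset_image
  have hc : ι c₀ ∈ G' := (hG' _).2 ⟨c₀, rfl⟩
  have hT₀ : ∀ x ∈ T₀.image ι, x ∈ G' := by
    intro x hx
    obtain ⟨m, -, rfl⟩ := Finset.mem_image.1 hx
    exact (hG' _).2 ⟨m, rfl⟩
  have hT₁ : ∀ x ∈ T₁.image ι, x ∈ G' := by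
    intro x hx
    obtain ⟨m, -, rfl⟩ := Finset.mem_image.1 hx
    exact (hG' _).2 ⟨m, rfl⟩
  have hcm₀' : ∀ x ∈ G', x ∈ T₀.image ι ↔ ι c₀ * x ∉ T₀.image ι := by
    intro x hx
    obtain ⟨m, rfl⟩ := (hG' x).1 hx
    rw [hmemI, ← hιadd, hmemI]
    exact hcm₀ m
  have hcm₁' : ∀ x ∈ G', x ∈ T₁.image ι ↔ ι c₀ * x ∉ T₁.image ι := by
    intro x hx
    obtain ⟨m, rfl⟩ := (hG' x).1 hx
    rw [hmemI, ← hιadd, hmemI]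
    exact hcm₁ m
  have hprim' : ∀ v ∈ G', v ≠ 1 → ∃ w : G, ¬ (w ∈ T₀.image ι ↔ v * w ∈ T₀.image ι) := by
    intro v hv hv1
    obtain ⟨m, rfl⟩ := (hG' v).1 hv
    have hm : m ≠ 0 := fun h => hv1 (by rw [h, hιzero])
    obtain ⟨w, hw⟩ := hprim m hm
    exact ⟨ι w, fun h => hw (by rwa [hmemI, ← hιadd, hmemI] at h)⟩
  have hntr' : ∀ d ∈ G', ∃ w : G, ¬ (w ∈ T₁.image ι ↔ d * w ∈ T₀.image ι) := by
    intro d hd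
    obtain ⟨m, rfl⟩ := (hG' d).1 hd
    obtain ⟨w, hw⟩ := hntr m
    exact ⟨ι w, fun h => hw (by rwa [hmemI, ← hιadd, hmemI] at h)⟩
  have hχ₀' : ∑ x ∈ T₀.image ι, χ (Additive.ofMul x) = 0 := by
    rw [Finset.sum_image fun a _ b _ h => hιinj h]
    simpa only [hι, ofMul_toMul] using hχ₀
  have hχ₁' : ∑ x ∈ T₁.image ι, χ (Additive.ofMul x) = 0 := by
    rw [Finset.sum_image fun a _ b _ h => hιinj h]
    simpa only [hι, ofMul_toMul] using hχ₁
  exact exists_finset_of_subgroup_char G' hc (T₀.image ι) (T₁.image ι) hT₀ hT₁ hcm₀' hcm₁' hprim' hntr' χ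
    hχ₀' hχ₁'

variable {K : Type} [Field K] [NumberField K] [IsCMField K]

/-- **SUBGROUP INDUCTION, character form, on a MODEL (field level).**  `K/ℚ` Galois CM with COMMUTATIVE Galois
group; `j : M ↪ Gal(K/ℚ)` injective with `j(c₀) = c` (complex conjugation); `T₀ ⊆ M` a CM set for `c₀` with
trivial stabiliser, `T₁ ⊆ M` a CM set of which `T₀` is not a translate; `χ` an ODD character of `Gal(K/ℚ)`
(`χ(c) = −1`) with `Σ_{T₀} χ∘j = Σ_{T₁} χ∘j = 0`.  Then `K` has a PRIMITIVE DEGENERATE CM type (Kubota's Lemma 2).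
[cite: Kubota1965, §4 Lemma 2] [cite: Shimura1998, §8.1, §8.2 Prop. 26] -/
theorem exists_isPrimitive_not_isNondegenerate_of_model_char [IsGalois ℚ K]
    (hcomm : ∀ g h : K ≃ₐ[ℚ] K, g * h = h * g) {M : Type*} [AddCommGroup M]
    (j : M →+ Additive (K ≃ₐ[ℚ] K)) (hj : Function.Injective j) (c₀ : M)
    (hc : Additive.toMul (j c₀) = (IsCMField.complexConj K).restrictScalars ℚ) (T₀ T₁ : Finset M)
    (hcm₀ : ∀ x : M, x ∈ T₀ ↔ c₀ + x ∉ T₀) (hcm₁ : ∀ x : M, x ∈ T₁ ↔ c₀ + x ∉ T₁)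
    (hprim : ∀ v : M, v ≠ 0 → ∃ w : M, ¬ (w ∈ T₀ ↔ v + w ∈ T₀))
    (hntr : ∀ d : M, ∃ w : M, ¬ (w ∈ T₁ ↔ d + w ∈ T₀))
    (χ : AddChar (Additive (K ≃ₐ[ℚ] K)) ℂ) (hχc : χ (j c₀) = -1)
    (hχ₀ : ∑ x ∈ T₀, χ (j x) = 0) (hχ₁ : ∑ x ∈ T₁, χ (j x) = 0) (φ₀ : K →+* ℂ) :
    ∃ Φ : CMType K, IsPrimitive (ℂ ≃+* ℂ) Φ.1 φ₀ ∧ ¬ IsNondegenerate Φ := by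
  letI : CommGroup (K ≃ₐ[ℚ] K) := { (inferInstance : Group (K ≃ₐ[ℚ] K)) with mul_comm := hcomm }
  obtain ⟨T, hcmT, hprimT, hχT⟩ :=
    exists_finset_of_model_char j hj c₀ T₀ T₁ hcm₀ hcm₁ hprim hntr χ hχ₀ hχ₁
  rw [hc] at hcmT
  have hχc' : χ (Additive.ofMul ((IsCMField.complexConj K).restrictScalars ℚ)) = -1 := by
    rw [← hc, ofMul_toMul]
    exact hχc
  obtain ⟨Φ, hΦprim, hΦdeg, -⟩ :=
    exists_isPrimitive_not_isNondegenerate_of_galoisFinset_char hcomm T hcmT hprimT χ hχc' hχT φ₀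
  exact ⟨Φ, hΦprim, hΦdeg⟩

/-- **Realisation form on a MODEL**: under the hypotheses of
`exists_isPrimitive_not_isNondegenerate_of_model_char` there is a SIMPLE abelian variety of dimension `[K:ℚ]/2`
with complex multiplication by `K` whose CM type is DEGENERATE, carrying an exceptional Hodge class (rational, of
type `(m,m)`, outside the complexified divisor ring) on some power. [cite: Shimura1998, §6.2 Thm. 3 and §8.2
Prop. 26] [cite: Gordon1999HodgeAVSurvey, Thm. 6.4] [cite: Kubota1965, §4 Lemma 2] -/
theorem exists_simple_degenerate_of_model_char [IsGalois ℚ K]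
    (hcomm : ∀ g h : K ≃ₐ[ℚ] K, g * h = h * g) {M : Type*} [AddCommGroup M]
    (j : M →+ Additive (K ≃ₐ[ℚ] K)) (hj : Function.Injective j) (c₀ : M)
    (hc : Additive.toMul (j c₀) = (IsCMField.complexConj K).restrictScalars ℚ) (T₀ T₁ : Finset M)
    (hcm₀ : ∀ x : M, x ∈ T₀ ↔ c₀ + x ∉ T₀) (hcm₁ : ∀ x : M, x ∈ T₁ ↔ c₀ + x ∉ T₁)
    (hprim : ∀ v : M, v ≠ 0 → ∃ w : M, ¬ (w ∈ T₀ ↔ v + w ∈ T₀))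
    (hntr : ∀ d : M, ∃ w : M, ¬ (w ∈ T₁ ↔ d + w ∈ T₀))
    (χ : AddChar (Additive (K ≃ₐ[ℚ] K)) ℂ) (hχc : χ (j c₀) = -1)
    (hχ₀ : ∑ x ∈ T₀, χ (j x) = 0) (hχ₁ : ∑ x ∈ T₁, χ (j x) = 0) :
    ∃ (Φ : CMType K) (φ₀ : K →+* ℂ) (A : AbelianVariety ℂ) (ι : 𝓞 K →+* End A)
      (θ : K →+* Module.End ℂ (complexBetti A.X 1)),
      IsPrimitive (ℂ ≃+* ℂ) Φ.1 φ₀ ∧ ¬ IsNondegenerate Φ ∧ IsCMTypeRealisation Φ A ι θ ∧ A.IsSimple ∧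
      A.dim = Module.finrank ℚ K / 2 ∧
      ∃ n m : ℕ, ∃ x : complexBetti (⨁ fun _ : Fin n => A).X (2 * m), IsRationalClass x ∧
        IsOfHodgeType (⨁ fun _ : Fin n => A).dim (⨁ fun _ : Fin n => A).X (2 * m) m m x ∧
        x ∉ divisorClassesSpan (⨁ fun _ : Fin n => A).X (⨁ fun _ : Fin n => A).dim m := by
  obtain ⟨φ₀⟩ := (inferInstance : Nonempty (K →+* ℂ))
  obtain ⟨Φ, hprimΦ, hdeg⟩ := exists_isPrimitive_not_isNondegenerate_of_model_char hcomm j hj c₀ hc T₀ T₁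
    hcm₀ hcm₁ hprim hntr χ hχc hχ₀ hχ₁ φ₀
  obtain ⟨A, ι, θ, hA, hs, hdim⟩ := exists_simple_realisation_of_isPrimitive Φ φ₀ hprimΦ
  exact ⟨Φ, φ₀, A, ι, θ, hprimΦ, hdeg, hA, hs, hdim,
    exists_exceptional_pow_of_not_isNondegenerate φ₀ hprimΦ hdeg hA⟩

end Model

/-! ## §2 Sign sets: CM sets on `ℤ/2 × X` for `c₀ = (1, 0)` -/

section SignSet

variable {X : Type*} [AddCommGroup X]

/-- In `ℤ/2`: `1 + i = 1 ↔ i ≠ 1`. [folklore] -/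
theorem one_add_eq_one_iff_ne_one (i : ZMod 2) : 1 + i = 1 ↔ ¬ i = 1 := by
  rcases zmod_two_cases i with rfl | rfl <;> decide

/-- **Sign sets are CM sets**: `T_N = {(i, x) : i = 1 ↔ x ∈ N} ⊆ ℤ/2 × X` contains exactly one of `m`,
`(1,0) + m` for every `m`. [cite: Shimura1998, §8.1] -/
theorem signSet_cm {N : Finset X} {T : Finset (ZMod 2 × X)} (hT : ∀ m, m ∈ T ↔ (m.1 = 1 ↔ m.2 ∈ N))
    (m : ZMod 2 × X) : m ∈ T ↔ (1, 0) + m ∉ T := by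
  obtain ⟨i, x⟩ := m
  rw [hT, hT, Prod.mk_add_mk, zero_add, one_add_eq_one_iff_ne_one]
  tauto

/-- **Trivial stabiliser of a sign set.**  If `N ⊆ X` is invariant under no non-zero translation and no
translate of `N` is the complement of `N`, then `T_N` has trivial stabiliser in `ℤ/2 × X` (a stabilising `(0, x₀)`
translates `N` to itself, a stabilising `(1, x₀)` translates `N` to its complement). [cite: Shimura1998, §8.2
Prop. 26] -/
theorem signSet_prim {N : Finset X} {T : Finset (ZMod 2 × X)} (hT : ∀ m, m ∈ T ↔ (m.1 = 1 ↔ m.2 ∈ N))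
    (ha : ∀ x₀ : X, x₀ ≠ 0 → ∃ y : X, ¬ (y ∈ N ↔ x₀ + y ∈ N))
    (hb : ∀ x₀ : X, ∃ y : X, (y ∈ N ↔ x₀ + y ∈ N)) :
    ∀ v : ZMod 2 × X, v ≠ 0 → ∃ w : ZMod 2 × X, ¬ (w ∈ T ↔ v + w ∈ T) := by
  have h01 : ((0 : ZMod 2) = 1) ↔ False := by decide
  rintro ⟨ε, x₀⟩ hv
  rcases zmod_two_cases ε with rfl | rfl
  · have hx₀ : x₀ ≠ 0 := fun h => hv (by rw [h]; rfl)
    obtain ⟨y, hy⟩ := ha x₀ hx₀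
    refine ⟨(0, y), fun h => hy ?_⟩
    simp only [hT, Prod.mk_add_mk, add_zero, h01, false_iff] at h
    tauto
  · obtain ⟨y, hy⟩ := hb x₀
    refine ⟨(0, y), fun h => ?_⟩
    simp only [hT, Prod.mk_add_mk, add_zero, h01, false_iff, true_iff] at h
    tauto

/-- **A sign set that is not a translate of another.**  If no translate of `N₀` is `N₁` and no translate of
`N₀` is the complement of `N₁`, then `T_{N₀}` is not a translate of `T_{N₁}` in `ℤ/2 × X`. [cite: Shimura1998,
§8.1] -/
theorem signSet_ntr {N₀ N₁ : Finset X} {T₀ T₁ : Finset (ZMod 2 × X)}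
    (hT₀ : ∀ m, m ∈ T₀ ↔ (m.1 = 1 ↔ m.2 ∈ N₀)) (hT₁ : ∀ m, m ∈ T₁ ↔ (m.1 = 1 ↔ m.2 ∈ N₁))
    (ha : ∀ x₀ : X, ∃ y : X, ¬ (y ∈ N₁ ↔ x₀ + y ∈ N₀))
    (hb : ∀ x₀ : X, ∃ y : X, (y ∈ N₁ ↔ x₀ + y ∈ N₀)) :
    ∀ d : ZMod 2 × X, ∃ w : ZMod 2 × X, ¬ (w ∈ T₁ ↔ d + w ∈ T₀) := by
  have h01 : ((0 : ZMod 2) = 1) ↔ False := by decide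
  rintro ⟨ε, x₀⟩
  rcases zmod_two_cases ε with rfl | rfl
  · obtain ⟨y, hy⟩ := ha x₀
    refine ⟨(0, y), fun h => hy ?_⟩
    simp only [hT₀, hT₁, Prod.mk_add_mk, add_zero, h01, false_iff] at h
    tauto
  · obtain ⟨y, hy⟩ := hb x₀
    refine ⟨(0, y), fun h => ?_⟩
    simp only [hT₀, hT₁, Prod.mk_add_mk, add_zero, h01, false_iff, true_iff] at h
    tauto

/-- `χ(1, x) = χ(1, 0) χ(0, x)` on `ℤ/2 × X`. [folklore] -/
theorem addChar_one_mk (χ : AddChar (ZMod 2 × X) ℂ) (x : X) : χ (1, x) = χ (1, 0) * χ (0, x) := by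
  rw [← AddChar.map_add_eq_mul, Prod.mk_add_mk, add_zero, zero_add]

/-- **The character sum over a sign set**: for a character `χ` of `ℤ/2 × X` with `χ(1,0) = −1`,
`Σ_{T_N} χ = Σ_{x ∈ X} χ(0,x) − 2 Σ_{x ∈ N} χ(0,x)`. [cite: Kubota1965, §4 Lemma 2 (proof)] -/
theorem sum_signSet [Fintype X] {N : Finset X} {T : Finset (ZMod 2 × X)}
    (hT : ∀ m, m ∈ T ↔ (m.1 = 1 ↔ m.2 ∈ N))
    (χ : AddChar (ZMod 2 × X) ℂ) (hc : χ (1, 0) = -1) :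
    ∑ m ∈ T, χ m = ∑ x, χ (0, x) - 2 * ∑ x ∈ N, χ (0, x) := by
  have h01 : ((0 : ZMod 2) = 1) ↔ False := by decide
  have h10 : ((1 : ZMod 2) = 0) ↔ False := by decide
  -- `T = (X ∖ N) × {0} ⊔ N × {1}`
  have hdec : T = (Finset.univ.filter fun x : X => x ∉ N).image (fun x => ((0 : ZMod 2), x)) ∪
      N.image (fun x => ((1 : ZMod 2), x)) := by
    ext ⟨i, x⟩
    rw [hT, Finset.mem_union, Finset.mem_image, Finset.mem_image]
    rcases zmod_two_cases i with rfl | rfl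
    · simp [h01, h10]
    · simp [h01]
  have hdisj : Disjoint ((Finset.univ.filter fun x : X => x ∉ N).image (fun x => ((0 : ZMod 2), x)))
      (N.image (fun x => ((1 : ZMod 2), x))) := by
    rw [Finset.disjoint_left]
    rintro ⟨i, x⟩ h0 h1
    obtain ⟨a, -, ha⟩ := Finset.mem_image.1 h0
    obtain ⟨b, -, hb⟩ := Finset.mem_image.1 h1
    have hi0 : i = 0 := (Prod.mk.inj ha).1.symm
    have hi1 : i = 1 := (Prod.mk.inj hb).1.symm
    exact absurd (hi0.symm.trans hi1) (by decide)
  rw [hdec, Finset.sum_union hdisj, Finset.sum_image fun a _ b _ h => (Prod.mk.inj h).2,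
    Finset.sum_image fun a _ b _ h => (Prod.mk.inj h).2]
  have h1x : ∀ x : X, χ (1, x) = -χ (0, x) := fun x => by rw [addChar_one_mk, hc, neg_one_mul]
  simp_rw [h1x, Finset.sum_neg_distrib]
  have hsplit := Finset.sum_filter_add_sum_filter_not Finset.univ (fun x : X => x ∈ N) (fun x => χ (0, x))
  have hfil : (Finset.univ.filter fun x : X => x ∈ N) = N := by
    ext x
    simp only [Finset.mem_filter, Finset.mem_univ, true_and]
  rw [hfil] at hsplit
  rw [← hsplit]
  ring

/-- **Balanced sign sets** (`χ` trivial on `X`, `2|N| = |X|`) are killed by `χ`. [cite: Gordon1999HodgeAVSurvey,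
§9.4.3 (Theorem [B.140])] -/
theorem sum_signSet_eq_zero_of_trivial [Fintype X] {N : Finset X} {T : Finset (ZMod 2 × X)}
    (hT : ∀ m, m ∈ T ↔ (m.1 = 1 ↔ m.2 ∈ N)) (χ : AddChar (ZMod 2 × X) ℂ) (hc : χ (1, 0) = -1)
    (hX : ∀ x : X, χ (0, x) = 1) (hN : 2 * N.card = Fintype.card X) : ∑ m ∈ T, χ m = 0 := by
  rw [sum_signSet hT χ hc, Finset.sum_congr rfl fun x _ => hX x, Finset.sum_congr rfl fun x _ => hX x,
    Finset.sum_const, Finset.sum_const, Finset.card_univ, nsmul_eq_mul, nsmul_eq_mul, mul_one, mul_one,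
    ← hN]
  push_cast
  ring

/-- **Sign sets with vanishing sums** (`χ|_X` non-trivial — then `Σ_X χ = 0` — and `Σ_N χ = 0`) are killed by
`χ`: the mechanism of degenerate CM types NOT of Weil type. [cite: Kubota1965, §4 Lemma 2]
[cite: Gordon1999HodgeAVSurvey, §9.4.2] -/
theorem sum_signSet_eq_zero_of_sum_eq_zero [Fintype X] {N : Finset X} {T : Finset (ZMod 2 × X)}
    (hT : ∀ m, m ∈ T ↔ (m.1 = 1 ↔ m.2 ∈ N)) (χ : AddChar (ZMod 2 × X) ℂ) (hc : χ (1, 0) = -1)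
    {x₁ : X} (hx₁ : χ (0, x₁) ≠ 1) (hN : ∑ x ∈ N, χ (0, x) = 0) : ∑ m ∈ T, χ m = 0 := by
  rw [sum_signSet hT χ hc, hN, mul_zero, sub_zero]
  -- `x ↦ χ(0, x)` is a non-trivial character of `X`
  set ψ : AddChar X ℂ := χ.compAddMonoidHom (AddMonoidHom.inr (ZMod 2) X) with hψ
  have hψx : ∀ x, ψ x = χ (0, x) := fun x => by
    rw [hψ, AddChar.compAddMonoidHom_apply, AddMonoidHom.inr_apply]
  have hψ0 : ψ ≠ 0 := fun h => hx₁ (by rw [← hψx, h, AddChar.zero_apply])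
  have hsum := AddChar.sum_eq_zero_iff_ne_zero.2 hψ0
  simp_rw [hψx] at hsum
  exact hsum

/-- A character of `ℤ/n` is determined by its value at `1`: `ψ(k) = ψ(1)^k`. [folklore] -/
theorem addChar_zmod_apply {n : ℕ} [NeZero n] (ψ : AddChar (ZMod n) ℂ) (k : ZMod n) :
    ψ k = ψ 1 ^ k.val := by
  conv_lhs => rw [← ZMod.natCast_zmod_val k, ← nsmul_one k.val]
  rw [AddChar.map_nsmul_eq_pow]

/-- `χ(0, (a, b)) = χ(0, (a, 0)) χ(0, (0, b))` on `ℤ/2 × (A × B)`. [folklore] -/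
theorem addChar_zero_mk_mk {A B : Type*} [AddCommGroup A] [AddCommGroup B] (χ : AddChar (ZMod 2 × (A × B)) ℂ)
    (a : A) (b : B) : χ (0, (a, b)) = χ (0, (a, 0)) * χ (0, (0, b)) := by
  rw [← AddChar.map_add_eq_mul, Prod.mk_add_mk, Prod.mk_add_mk, add_zero, add_zero, zero_add]

/-- On `ℤ/2 × (A × ℤ/n)`: if `χ(0, (0, 1)) = 1` then `χ(0, (a, b)) = χ(0, (a, 0))`. [folklore] -/
theorem addChar_zero_mk_eq_of_apply_eq_one {A : Type*} [AddCommGroup A] {n : ℕ} [NeZero n]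
    (χ : AddChar (ZMod 2 × (A × ZMod n)) ℂ) (h1 : χ (0, (0, 1)) = 1) (a : A) (b : ZMod n) :
    χ (0, (a, b)) = χ (0, (a, 0)) := by
  rw [addChar_zero_mk_mk]
  set ψ : AddChar (ZMod n) ℂ :=
    χ.compAddMonoidHom ((AddMonoidHom.inr (ZMod 2) (A × ZMod n)).comp (AddMonoidHom.inr A (ZMod n))) with hψ
  have hψx : ∀ k, ψ k = χ (0, (0, k)) := fun k => by
    rw [hψ, AddChar.compAddMonoidHom_apply, AddMonoidHom.comp_apply, AddMonoidHom.inr_apply,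
      AddMonoidHom.inr_apply]
  rw [← hψx, addChar_zmod_apply ψ b, hψx, h1, one_pow, mul_one]

end SignSet

end Summit.HodgeConjecture.CorCM.AbelianOddPart

end
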